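import Mathlib
import Summits.MatrixMultiplication.MatrixMultiplication.Theorems.LevelGradedCohnUmansLevelOneGL2DesignsStubTangencySetsHermitian
import Summits.MatrixMultiplication.MatrixMultiplication.Theorems.LevelGradedCohnUmansLevelOneGL2DesignsStubTangencySetsUnitalBoundCounting

/-!
# The unital bound for `stub_tangencySets`, part 4: affine tangency sets — `N(N-1) ≤ q³ - q`, exact for `q` square

Wall-breaker axis "Hermitian unital constructions" (k7/12) for the stub `stub_tangencySets` of the
crux `LevelOneGL2Designs` (stmt-MatrixMultiplication-14080, route LevelGradedCohnUmans).

By `FlagLine.TangencyHermitian.stub_tangencySets_iff_affineTangencySets` (seat 10) the stub is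
equivalent to the existence of large AFFINE TANGENCY SETS `V ⊆ 𝔽_p²`: every `v ∈ V` carries a line
`{w | u ⬝ᵥ w = u ⬝ᵥ v}` (`u ≠ 0`, arbitrary position) meeting `V` only in `v`.  For that un-anchored
object the count of part 2 simplifies (no origin pencil) and gives, over any finite field of order `q`:

* `tangencySet_card_mul_pred_le` — **`|V|(|V| - 1) ≤ q³ - q`** (`|V| ≤ q^{3/2} + 1/2`): first and
  second line moments (`sum_sum_sq_card_filter'`, the origin-free form of part 1's second moment),
  the `(q-1)|V|` tangent representatives carry one point each, Cauchy–Schwarz on the rest;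
* `tangencySet_card_le_of_card_sq` — `|F| = r²` ⇒ `|V| ≤ r³`;
* `hermitian_tangencySet` — the `r³` affine points of the Hermitian curve `b^r + b = a^{r+1}`
  (`card_hermitian`, seat 10) with the tangents `a^r x - y = const` form a tangency set of size
  EXACTLY `r³` (the line at infinity is the tangent at the curve's unique point at infinity, so
  nothing is lost); hence `hermitian_tangencySet_extremal`: **max |V| = |F|^{3/2} on the nose** for
  every field of square order — the affine unital is the extremal tangency set, not just up to
  constants;
* prime field: `affineTangencySet_card_mul_pred_le` (`|V|(|V|-1) ≤ p³ - p`) and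
  `affineTangencySet_card_lt` (`|V| < p^{3/2} + 1`) in the vocabulary of seat 10's equivalence.

Projective ancestor: Illés–Szőnyi–Wettl 1991 (`|SRS| ≤ q√q + 1` in `PG(2,q)`, equality iff unital);
the affine statement here is sharper by the point at infinity and is what the stub's equivalence
consumes.  Elementary; no definitions.
-/

-- `Summit.MatrixMultiplication.MatrixMultiplication.…` is the tree's mandated summit/problem namespace (D-0017).
set_option linter.dupNamespace false

namespace Summit.MatrixMultiplication.MatrixMultiplication.Theorems.LevelOneGL2Designs.UnitalBound

open Finset Matrix
open Summit.MatrixMultiplication.MatrixMultiplication.Theorems.LevelOneGL2Designs.FlagLine.TangencyHermitian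
  (card_hermitian qpow_sub qpow_qpow two_le_of_card_eq_sq)

variable {F : Type*} [Field F] [Fintype F] [DecidableEq F]

/-! ## The second moment without the origin condition -/

/-- For fixed `z, z'`, the number of non-zero `u` with `u ⬝ᵥ z = u ⬝ᵥ z'` is `|F| - 1`, plus
`|F|² - |F|` more when `z = z'` (origin-free form of part 1's lemma). [elementary] -/
theorem card_ne_zero_dotProduct_eq_dotProduct' (z z' : Fin 2 → F) :
    ((univ.filter fun u : Fin 2 → F => u ≠ 0).filter fun u => u ⬝ᵥ z = u ⬝ᵥ z').card
      = (Fintype.card F - 1) + if z = z' then Fintype.card F ^ 2 - Fintype.card F else 0 := by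
  split_ifs with h
  · subst h
    rw [filter_true_of_mem (fun u _ => rfl), card_filter_ne_zero]
    have h1 : 1 ≤ Fintype.card F := Fintype.card_pos
    have h2 : Fintype.card F ≤ Fintype.card F ^ 2 := by nlinarith
    omega
  · have hsub : z - z' ≠ 0 := sub_ne_zero.2 h
    have : ((univ.filter fun u : Fin 2 → F => u ≠ 0).filter fun u => u ⬝ᵥ z = u ⬝ᵥ z')
        = ((univ.filter fun u : Fin 2 → F => u ≠ 0).filter fun u => u ⬝ᵥ (z - z') = 0) := by
      ext u
      simp only [mem_filter, dotProduct_sub, sub_eq_zero]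
    rw [this, card_ne_zero_orth hsub, add_zero]

/-- **Second moment of the line counts, any point set**: summing `#{z ∈ X | u ⬝ᵥ z = t}²` over all
`u ≠ 0` and all `t` gives `(|F| - 1)|X|² + (|F|² - |F|)|X|`. [elementary] -/
theorem sum_sum_sq_card_filter' (X : Finset (Fin 2 → F)) :
    ∑ u ∈ univ.filter (fun u : Fin 2 → F => u ≠ 0), ∑ t : F, (X.filter fun z => u ⬝ᵥ z = t).card ^ 2
      = (Fintype.card F - 1) * X.card ^ 2 + (Fintype.card F ^ 2 - Fintype.card F) * X.card := by
  set NZ := univ.filter (fun u : Fin 2 → F => u ≠ 0) with hNZ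
  calc ∑ u ∈ NZ, ∑ t : F, (X.filter fun z => u ⬝ᵥ z = t).card ^ 2
      = ∑ u ∈ NZ, ∑ z ∈ X, ∑ z' ∈ X, (if u ⬝ᵥ z = u ⬝ᵥ z' then 1 else 0) :=
        sum_congr rfl fun u _ => sum_sq_card_filter_eq X u
    _ = ∑ z ∈ X, ∑ u ∈ NZ, ∑ z' ∈ X, (if u ⬝ᵥ z = u ⬝ᵥ z' then 1 else 0) := sum_comm
    _ = ∑ z ∈ X, ∑ z' ∈ X, ∑ u ∈ NZ, (if u ⬝ᵥ z = u ⬝ᵥ z' then 1 else 0) :=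
        sum_congr rfl fun z _ => sum_comm
    _ = ∑ z ∈ X, ∑ z' ∈ X, (NZ.filter fun u => u ⬝ᵥ z = u ⬝ᵥ z').card := by
        simp_rw [card_filter]
    _ = ∑ z ∈ X, ∑ z' ∈ X,
          ((Fintype.card F - 1) + if z = z' then Fintype.card F ^ 2 - Fintype.card F else 0) :=
        sum_congr rfl fun z _ => sum_congr rfl fun z' _ => card_ne_zero_dotProduct_eq_dotProduct' z z'
    _ = ∑ z ∈ X, ((Fintype.card F - 1) * X.card + (Fintype.card F ^ 2 - Fintype.card F)) := by
        refine sum_congr rfl fun z hz => ?_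
        rw [sum_add_distrib, sum_const, smul_eq_mul, sum_ite_eq, if_pos hz, mul_comm]
    _ = (Fintype.card F - 1) * X.card ^ 2 + (Fintype.card F ^ 2 - Fintype.card F) * X.card := by
        rw [sum_const, smul_eq_mul]
        ring

/-- **First moment, any point set**: over all `u ≠ 0` and all `t`, the counts `#{z ∈ X | u ⬝ᵥ z = t}`
sum to `(|F|² - 1)|X|` (every point lies on exactly one level set of each `u`). [elementary] -/
theorem sum_sum_card_filter (X : Finset (Fin 2 → F)) :
    ∑ u ∈ univ.filter (fun u : Fin 2 → F => u ≠ 0), ∑ t : F, (X.filter fun z => u ⬝ᵥ z = t).card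
      = (Fintype.card F ^ 2 - 1) * X.card := by
  have h : ∀ u : Fin 2 → F, ∑ t : F, (X.filter fun z => u ⬝ᵥ z = t).card = X.card := fun u =>
    (card_eq_sum_card_fiberwise (f := fun z => u ⬝ᵥ z) (t := univ) fun _ _ => mem_univ _).symm
  simp_rw [h]
  rw [sum_const, smul_eq_mul, card_filter_ne_zero]

/-! ## Affine tangency sets -/

section Tangency

/-- **The unital bound for affine tangency sets.**  If every point `v` of `V ⊆ F²` lies on a line
`{w | u ⬝ᵥ w = u ⬝ᵥ v}` (`u ≠ 0`) containing no other point of `V`, then `|V|(|V| - 1) ≤ q³ - q`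
(`q = |F|`).  Double count `V` against all affine lines (pairs `(u,t)`, `u ≠ 0`, each line `q-1`
times): first moment `(q²-1)|V|`, second moment `(q-1)|V|² + (q²-q)|V|`, the `(q-1)|V|` tangent
pairs `(c • u_v, c·(u_v ⬝ᵥ v))` carry exactly one point, and Cauchy–Schwarz over the other
`(q-1)(q²+q-|V|)` pairs gives `q²|V| ≤ (q²+q-|V|)(|V|+q-1)`. [folklore; Illés–Szőnyi–Wettl 1991
for the projective plane] -/
theorem tangencySet_card_mul_pred_le (V : Finset (Fin 2 → F))
    (hV : ∀ v ∈ V, ∃ u : Fin 2 → F, u ≠ 0 ∧ ∀ w ∈ V, u ⬝ᵥ w = u ⬝ᵥ v → w = v) :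
    V.card * (V.card - 1) ≤ Fintype.card F ^ 3 - Fintype.card F := by
  classical
  choose! U hU0 hU using hV
  set q := Fintype.card F with hq
  set N := V.card with hN
  set NZ := univ.filter (fun u : Fin 2 → F => u ≠ 0) with hNZ
  set NZF := univ.filter (fun t : F => t ≠ 0) with hNZF
  set Λ := NZ ×ˢ (univ : Finset F) with hΛ
  have hq2 : 2 ≤ q := by
    have : 1 < Fintype.card F := Fintype.one_lt_card
    omega
  have hq1 : 1 ≤ q := by omega
  have hqq : q ≤ q ^ 2 := by nlinarith
  have hq21 : 1 ≤ q ^ 2 := by nlinarith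
  have hNZcard : NZ.card = q ^ 2 - 1 := card_filter_ne_zero
  have hNZFcard : NZF.card = q - 1 := by
    rw [hNZF, filter_ne' univ (0 : F), card_erase_of_mem (mem_univ _), card_univ]
  have hΛcard : Λ.card = (q ^ 2 - 1) * q := by rw [hΛ, card_product, hNZcard, card_univ]
  set k : (Fin 2 → F) → F → ℕ := fun u t => (V.filter fun z => u ⬝ᵥ z = t).card with hk
  have hsum1 : ∑ l ∈ Λ, k l.1 l.2 = (q ^ 2 - 1) * N := by
    rw [hΛ, sum_product]
    exact sum_sum_card_filter V
  have hsum2 : ∑ l ∈ Λ, k l.1 l.2 ^ 2 = (q - 1) * N ^ 2 + (q ^ 2 - q) * N := by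
    rw [hΛ, sum_product]
    exact sum_sum_sq_card_filter' V
  -- the tangent family
  let τ : (Fin 2 → F) × F → (Fin 2 → F) × F := fun vc => (vc.2 • U vc.1, vc.2 * (U vc.1 ⬝ᵥ vc.1))
  set T := (V ×ˢ NZF).image τ with hT
  have hτinj : Set.InjOn τ ((V ×ˢ NZF : Finset _) : Set ((Fin 2 → F) × F)) := by
    rintro ⟨v, c⟩ hvc ⟨v', c'⟩ hvc' h
    rw [mem_coe, mem_product] at hvc hvc'
    have hc0 : c ≠ 0 := (mem_filter.1 hvc.2).2
    have h1 : c • U v = c' • U v' := congrArg Prod.fst h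
    have h2 : c * (U v ⬝ᵥ v) = c' * (U v' ⬝ᵥ v') := congrArg Prod.snd h
    -- `v'` lies on the line of the pair, which is the tangent at `v`
    have h3 : (c • U v) ⬝ᵥ v' = c * (U v ⬝ᵥ v) := by
      rw [h1, h2, smul_dotProduct, smul_eq_mul]
    rw [smul_dotProduct, smul_eq_mul] at h3
    have h4 : U v ⬝ᵥ v' = U v ⬝ᵥ v := mul_left_cancel₀ hc0 h3
    have hvv : v' = v := hU v hvc.1 v' hvc'.1 h4
    subst hvv
    have h5 : (c - c') • U v' = 0 := by rw [sub_smul, h1, sub_self]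
    have hcc : c = c' := sub_eq_zero.1 ((smul_eq_zero.1 h5).resolve_right (hU0 v' hvc.1))
    rw [hcc]
  have hTcard : T.card = N * (q - 1) := by
    rw [hT, card_image_of_injOn hτinj, card_product, hNZFcard]
  have hTsub : T ⊆ Λ := by
    intro l hl
    obtain ⟨⟨v, c⟩, hvc, rfl⟩ := mem_image.1 hl
    rw [mem_product] at hvc
    have hc0 : c ≠ 0 := (mem_filter.1 hvc.2).2
    exact mem_product.2 ⟨mem_filter.2 ⟨mem_univ _, smul_ne_zero hc0 (hU0 v hvc.1)⟩, mem_univ _⟩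
  have hTk : ∀ l ∈ T, k l.1 l.2 = 1 := by
    intro l hl
    obtain ⟨⟨v, c⟩, hvc, rfl⟩ := mem_image.1 hl
    rw [mem_product] at hvc
    have hc0 : c ≠ 0 := (mem_filter.1 hvc.2).2
    show (V.filter fun z => (c • U v) ⬝ᵥ z = c * (U v ⬝ᵥ v)).card = 1
    rw [card_eq_one]
    refine ⟨v, ?_⟩
    ext z
    simp only [mem_filter, mem_singleton, smul_dotProduct, smul_eq_mul]
    constructor
    · rintro ⟨hz, h⟩
      exact hU v hvc.1 z hz (mul_left_cancel₀ hc0 h)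
    · rintro rfl
      exact ⟨hvc.1, rfl⟩
  have hTsum : ∑ l ∈ T, k l.1 l.2 = T.card := by
    rw [card_eq_sum_ones]; exact sum_congr rfl hTk
  have hTsum2 : ∑ l ∈ T, k l.1 l.2 ^ 2 = T.card := by
    rw [card_eq_sum_ones]; exact sum_congr rfl fun l hl => by rw [hTk l hl, one_pow]
  have hs1 : ∑ l ∈ Λ \ T, k l.1 l.2 + T.card = (q ^ 2 - 1) * N := by
    rw [← hsum1, ← hTsum]; exact sum_sdiff hTsub
  have hs2 : ∑ l ∈ Λ \ T, k l.1 l.2 ^ 2 + T.card = (q - 1) * N ^ 2 + (q ^ 2 - q) * N := by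
    rw [← hsum2, ← hTsum2]; exact sum_sdiff hTsub
  have hcard : (Λ \ T).card + T.card = (q ^ 2 - 1) * q := by
    rw [← hΛcard]; exact card_sdiff_add_card_eq_card hTsub
  have hCS : (∑ l ∈ Λ \ T, k l.1 l.2) ^ 2 ≤ (Λ \ T).card * ∑ l ∈ Λ \ T, k l.1 l.2 ^ 2 :=
    sq_sum_le_card_mul_sum_sq
  -- algebra in `ℤ`
  rcases Nat.eq_zero_or_pos N with hN0 | hNpos
  · rw [hN0]; simp
  set σ := ∑ l ∈ Λ \ T, k l.1 l.2 with hσ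
  set B := ∑ l ∈ Λ \ T, k l.1 l.2 ^ 2 with hB
  set m := (Λ \ T).card with hm
  rw [hTcard] at hs1 hs2 hcard
  have hs1' : (σ : ℤ) + N * (q - 1) = (q ^ 2 - 1) * N := by
    have := hs1; zify [hq1, hq21] at this; linarith
  have hs2' : (B : ℤ) + N * (q - 1) = (q - 1) * N ^ 2 + (q ^ 2 - q) * N := by
    have := hs2; zify [hq1, hqq] at this; linarith
  have hcard' : (m : ℤ) + N * (q - 1) = (q ^ 2 - 1) * q := by
    have := hcard; zify [hq1, hq21] at this; linarith
  have hCS' : (σ : ℤ) ^ 2 ≤ m * B := by exact_mod_cast hCS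
  have hq2z : (2 : ℤ) ≤ q := by exact_mod_cast hq2
  have hNposz : (0 : ℤ) < N := by exact_mod_cast hNpos
  have hσ' : (σ : ℤ) = (q - 1) * q * N := by linear_combination hs1'
  have hB' : (B : ℤ) = (q - 1) * N * (N + q - 1) := by linear_combination hs2'
  have hm' : (m : ℤ) = (q - 1) * (q ^ 2 + q - N) := by linear_combination hcard'
  -- `(q-1)² q² N² ≤ (q-1)² (q²+q-N) N (N+q-1)`, i.e. `q² N ≤ (q²+q-N)(N+q-1)`
  have key : ((q : ℤ) - 1) ^ 2 * N * ((q ^ 2 + q - N) * (N + q - 1) - q ^ 2 * N)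
      = (m : ℤ) * B - (σ : ℤ) ^ 2 := by
    rw [hσ', hB', hm']; ring
  have hpos : (0 : ℤ) ≤ ((q : ℤ) - 1) ^ 2 * N * ((q ^ 2 + q - N) * (N + q - 1) - q ^ 2 * N) := by
    rw [key]; exact sub_nonneg.2 hCS'
  have hfac : (0 : ℤ) < ((q : ℤ) - 1) ^ 2 * N := mul_pos (pow_pos (by linarith) 2) hNposz
  have hfin : (0 : ℤ) ≤ ((q : ℤ) ^ 2 + q - N) * (N + q - 1) - q ^ 2 * N :=
    nonneg_of_mul_nonneg_right hpos hfac
  -- `(q²+q-N)(N+q-1) - q²N = q³ - q - N² + N`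
  have hid : ((q : ℤ) ^ 2 + q - N) * (N + q - 1) - q ^ 2 * N = ((q : ℤ) ^ 3 - q) - N * (N - 1) := by
    ring
  rw [hid] at hfin
  have hfin' : (N : ℤ) * (N - 1) ≤ (q : ℤ) ^ 3 - q := sub_nonneg.1 hfin
  have hN1 : 1 ≤ N := hNpos
  have hq3 : q ≤ q ^ 3 := by
    calc q = q ^ 1 := (pow_one q).symm
      _ ≤ q ^ 3 := Nat.pow_le_pow_right hq1 (by norm_num)
  zify [hN1, hq3]
  exact hfin'

/-- **Exactness over square fields, upper half**: `|F| = r²` ⇒ every affine tangency set has at most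
`r³ = |F|^{3/2}` points (`|V|(|V|-1) ≤ r⁶ - r² < (r³+1)r³`). [folklore] -/
theorem tangencySet_card_le_of_card_sq (r : ℕ) (hF : Fintype.card F = r ^ 2) (V : Finset (Fin 2 → F))
    (hV : ∀ v ∈ V, ∃ u : Fin 2 → F, u ≠ 0 ∧ ∀ w ∈ V, u ⬝ᵥ w = u ⬝ᵥ v → w = v) :
    V.card ≤ r ^ 3 := by
  have h := tangencySet_card_mul_pred_le V hV
  rw [hF] at h
  have hr : 1 ≤ r := by
    rcases Nat.eq_zero_or_pos r with h0 | h0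
    · rw [h0] at hF
      exact absurd hF Fintype.card_ne_zero
    · exact h0
  have hr3 : 1 ≤ r ^ 3 := Nat.one_le_pow _ _ hr
  by_contra hlt
  have hN : r ^ 3 + 1 ≤ V.card := by omega
  have h1 : (r ^ 3 + 1) * (r ^ 3) ≤ V.card * (V.card - 1) :=
    Nat.mul_le_mul hN (by omega)
  have h2 : (r ^ 2) ^ 3 - r ^ 2 ≤ (r ^ 2) ^ 3 := Nat.sub_le _ _
  have h3 : (r ^ 2) ^ 3 = r ^ 3 * r ^ 3 := by ring
  nlinarith [h, h1, h2, h3, hr3]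

/-- **The affine Hermitian unital is a tangency set of size `r³`.**  If `|F| = r²`, the `r³` points
of `H = {(a,b) : b^r + b = a^{r+1}}` (`card_hermitian`) with the lines `{(x,y) : a^r x - y = a^r a - b}`
(normal vector `(a^r, -1) ≠ 0`) form an affine tangency set: if `(a',b') ∈ H` lies on the line at
`(a,b)` then `b' = a^r a' - b^r`, `b'^r = a a'^r - b`, and adding the two curve equations gives
`(a - a')^{r+1} = 0`.  (The line at infinity is the tangent at the unique point of `H` at infinity, so
ALL affine points are kept — one more than the origin-anchored `hermitian_srs`.) [folklore] -/
theorem hermitian_tangencySet (r : ℕ) (hF : Fintype.card F = r ^ 2) :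
    ∃ V : Finset (Fin 2 → F), V.card = r ^ 3 ∧
      ∀ v ∈ V, ∃ u : Fin 2 → F, u ≠ 0 ∧ ∀ w ∈ V, u ⬝ᵥ w = u ⬝ᵥ v → w = v := by
  classical
  set H := univ.filter fun ab : F × F => ab.2 ^ r + ab.2 = ab.1 ^ (r + 1) with hH
  let Φ : F × F → (Fin 2 → F) := fun ab => ![ab.1, ab.2]
  have hΦ : Function.Injective Φ := by
    rintro ⟨a, b⟩ ⟨a', b'⟩ h
    have ha := congrFun h 0
    have hb := congrFun h 1
    simp only [Φ, Matrix.cons_val_zero, Matrix.cons_val_one, Matrix.cons_val_fin_one] at ha hb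
    rw [ha, hb]
  refine ⟨H.image Φ, by rw [card_image_of_injective _ hΦ, card_hermitian r hF], ?_⟩
  simp only [mem_image]
  rintro v ⟨⟨a, b⟩, habH, rfl⟩
  refine ⟨![a ^ r, -1], ?_, ?_⟩
  · intro h0
    have := congrFun h0 1
    simp at this
  · rintro w ⟨⟨a', b'⟩, habH', rfl⟩ h
    simp only [hH, mem_filter, mem_univ, true_and] at habH habH'
    simp only [Φ, vec2_dotProduct, Matrix.cons_val_zero, Matrix.cons_val_one,
      Matrix.cons_val_fin_one] at h
    -- h : a^r * a' + (-1) * b' = a^r * a + (-1) * b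
    rw [pow_succ] at habH habH'
    have key : b' = a ^ r * a' - a ^ r * a + b := by linear_combination -h
    have hbr : b = a ^ r * a - b ^ r := by linear_combination habH
    have key1 : b' = a ^ r * a' - b ^ r := by linear_combination key + hbr
    have key2 : b' ^ r = a * a' ^ r - b := by
      rw [key1, qpow_sub r hF, mul_pow, qpow_qpow r hF, qpow_qpow r hF]
    have h3 : (a - a') ^ (r + 1) = 0 := by
      rw [pow_succ, qpow_sub r hF]
      linear_combination key1 + key2 - habH - habH'
    have haa : a = a' := sub_eq_zero.1 ((pow_eq_zero_iff (Nat.succ_ne_zero r)).1 h3)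
    subst haa
    have hbb : b' = b := by rw [key1]; linear_combination -habH
    rw [hbb]

/-- **The affine unital is exactly extremal among tangency sets** (fields of square order `r²`):
a tangency set of size `r³ = |F|^{3/2}` exists (`hermitian_tangencySet`) and none is larger
(`tangencySet_card_le_of_card_sq`). [folklore] -/
theorem hermitian_tangencySet_extremal (r : ℕ) (hF : Fintype.card F = r ^ 2) :
    (∃ V : Finset (Fin 2 → F), V.card = r ^ 3 ∧
        ∀ v ∈ V, ∃ u : Fin 2 → F, u ≠ 0 ∧ ∀ w ∈ V, u ⬝ᵥ w = u ⬝ᵥ v → w = v) ∧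
      ∀ V : Finset (Fin 2 → F),
        (∀ v ∈ V, ∃ u : Fin 2 → F, u ≠ 0 ∧ ∀ w ∈ V, u ⬝ᵥ w = u ⬝ᵥ v → w = v) → V.card ≤ r ^ 3 :=
  ⟨hermitian_tangencySet r hF, fun V hV => tangencySet_card_le_of_card_sq r hF V hV⟩

end Tangency

/-! ## Prime field: the vocabulary of `stub_tangencySets_iff_affineTangencySets` -/

section PrimeField

variable {p : ℕ} [hp : Fact p.Prime]

/-- Over `ZMod p`: an affine tangency set `V` (the right-hand side of seat 10's equivalence
`stub_tangencySets_iff_affineTangencySets`) has `|V|(|V| - 1) ≤ p³ - p`. [folklore] -/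
theorem affineTangencySet_card_mul_pred_le (V : Finset (Fin 2 → ZMod p))
    (hV : ∀ v ∈ V, ∃ u : Fin 2 → ZMod p, u ≠ 0 ∧ ∀ w ∈ V, u ⬝ᵥ w = u ⬝ᵥ v → w = v) :
    V.card * (V.card - 1) ≤ p ^ 3 - p := by
  have h := tangencySet_card_mul_pred_le V hV
  rwa [ZMod.card] at h

/-- Real form: `|V| < p^{3/2} + 1` for every affine tangency set over `ZMod p` (from
`|V|(|V|-1) ≤ p³ - p`, i.e. `(|V| - 1)² < p³`). [folklore] -/
theorem affineTangencySet_card_lt (V : Finset (Fin 2 → ZMod p))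
    (hV : ∀ v ∈ V, ∃ u : Fin 2 → ZMod p, u ≠ 0 ∧ ∀ w ∈ V, u ⬝ᵥ w = u ⬝ᵥ v → w = v) :
    (V.card : ℝ) < (p : ℝ) ^ (3 / 2 : ℝ) + 1 := by
  have h := affineTangencySet_card_mul_pred_le V hV
  have hp1 : 1 ≤ p := hp.out.one_lt.le
  have hp3 : p ≤ p ^ 3 := by
    calc p = p ^ 1 := (pow_one p).symm
      _ ≤ p ^ 3 := Nat.pow_le_pow_right hp1 (by norm_num)
  rcases Nat.eq_zero_or_pos V.card with h0 | hpos
  · rw [h0]; push_cast; positivity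
  have hV1nat : 1 ≤ V.card := hpos
  have hsq : ((V.card : ℝ) - 1) ^ 2 < (p : ℝ) ^ 3 := by
    have h' : ((V.card : ℝ)) * ((V.card : ℝ) - 1) ≤ (p : ℝ) ^ 3 - p := by
      have := h; rify [hV1nat, hp3] at this; exact this
    have hp0 : (1 : ℝ) ≤ p := by exact_mod_cast hp1
    have hV1 : (1 : ℝ) ≤ V.card := by exact_mod_cast hpos
    nlinarith
  have hrpow : (p : ℝ) ^ (3 / 2 : ℝ) = Real.sqrt ((p : ℝ) ^ 3) := by
    rw [Real.sqrt_eq_rpow, ← Real.rpow_natCast, ← Real.rpow_mul (Nat.cast_nonneg p)]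
    norm_num
  have hlt : (V.card : ℝ) - 1 < Real.sqrt ((p : ℝ) ^ 3) := by
    calc (V.card : ℝ) - 1 ≤ |(V.card : ℝ) - 1| := le_abs_self _
      _ = Real.sqrt (((V.card : ℝ) - 1) ^ 2) := (Real.sqrt_sq_eq_abs _).symm
      _ < Real.sqrt ((p : ℝ) ^ 3) := Real.sqrt_lt_sqrt (sq_nonneg _) hsq
  rw [hrpow]
  linarith

end PrimeField

end Summit.MatrixMultiplication.MatrixMultiplication.Theorems.LevelOneGL2Designs.UnitalBound
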